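import Summits.ResolutionOfSingularities.ResolutionOfSingularities.Theorems.PurelyInseparableDim4ResConeRowLemma
import Summits.ResolutionOfSingularities.ResolutionOfSingularities.Theorems.PurelyInseparableDim4ResConeLossyTiltFreeStep
import HarnessLib
import HarnessLib.Audit.Tags

/-!
# Purely inseparable four-folds — the ROW LEMMA (RL) DRESSED ON THE CHAIN: at an immediate lose-both → satellite
# pair whose corner child is on the H-tail, the short level rows of the parent vanish (K2(p) lane, brick K29a
# LAYER 1, general `(p, d)`; cell `res-dim4-pi`)

[OURS · counted 0 · cell `res-dim4-pi` · K2(p) lane holder res-dim4-p-12 g3's brick K29a «ResConeContactSurfaceRows»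
(bus 2026-08-29 03:09Z / 04:33Z); the lemma res-dim4-idea-4 g4 (memo CONTACT-SURFACE.md §9 (RL-a)(RL-b)(RL)); kernel
res-dim4-p-9 g3 `…ResConeRowLemma` (p693699); letters res-dim4-p-5 g4 (`…LossyTiltFreePeel/Legality/Step`); seat
res-dim4-p-9 g4.]  Nothing here proves K2(p)/K2(5), `NoIsolatedTrap p p` or resolution of singularities in dimension
≥ 4 / characteristic `p`.  AI kernel work, weaker than expert review.

SETTING (idea-4 §9, in the tree's frame; `a ≠ a′` the two ACTIVE letters, the other two inert): three presented
states `s₀ →L→ s₁ →S→ s₂` of the point game `CentreBlowup.step q univ`,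
* `L` = the LOSE-BOTH step: chart `a`, translation `t·e_{a′}` (`t ≠ 0`; the boundary letter `a′` is translated
  away), parent boundary `x^{r₀} = x_a^α x_{a′}^β` (inert letters carry no boundary), `ord₀ F₀ = α + β + d`;
* `S` = the IMMEDIATE SATELLITE: chart `a′` at the origin; child boundary `x_a^{r_V} x_{a′}^{r_V + d − q}`,
  `r_V = α + β + d − q`, when the shade is the constant `d` (H-tail);
* «`C₂` ON THE H-TAIL» is read as: the degree-`o₂` monomials of `F₂` have `x_a`-exponent exactly `r₂ a = r_V`
  (the residual cone of `s₂` does not involve `x_a`: `e_a ∈ resVertex s₂`, `…PolarFree.single_mem_resVertex_iff_free`).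
CONTENT:
* §1 **`coeff_shear_eq_zero_of_loseBoth_satellite`** — (RL-b) TRANSPORT, any `q`: a monomial `x^E` of the sheared
  parent `shear_a^{t e_{a′}} F₀` with `|E| > r₂ a + q`, off the `q`-th-power coset, and
  `2|E| + E_{a′} + 2|E|_inert ≤ o₂ + 3q` is ABSENT — its two chart images survive the cleanings
  (`…LayerBirths.coeff_step_F_chartExponent` twice) and the second would be a monomial of `F₂` of degree `≤ o₂` with
  `x_a`-exponent `≠ r₂ a`.  (At `(5,4)` this is res-dim4-p-5 g4's `coeff_shear_eq_zero_of_legality` numerology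
  `e_{a′} + 2|e| + 2|e|_inert < 23`; here every `(q, d)` and no order hypothesis on `s₁` beyond the floor.)
* §2 **`row_eq_zero_of_loseBoth_satellite`** — (RL) for the three states: on the level-`ℓ` row
  `{e : e_a + e_{a′} = ℓ + i, |e|_inert = d − ℓ}` of `G₀ = F₀ / x^{r₀}` with `1 ≤ i`, `3i ≤ ℓ ≤ d` (a SHORT row) and off
  the coset (`q ∤ r_V + i`, or an inert exponent prime to `q`), every coefficient vanishes:
  §1 feeds the S-legality hypothesis of the kernel `…RowLemma.level_succ_le_three_mul_of_row_ne_zero`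
  (`N = 2ℓ + 1 − 2i`), whose conclusion `ℓ + 1 ≤ 3i` is absurd.  idea-4's reading: `R^{(ℓ)}_{ℓ+i}(C₀) = 0` for
  `1 ≤ i ≤ ⌊ℓ/3⌋`; `(p, d) = (5, 4)`: the degree-`8` rows of inert degree `≤ 1` (= res-dim4-p-5 g4's
  `coeff_eq_zero_of_degree_eight`, not restated); `(7, 6)`: `R₇ = R₈ = 0`, `R^{(5)}_6 = R^{(4)}_5 = R^{(3)}_4 = 0`.
* §3 **`chain_row_eq_zero_of_loseBoth_satellite`** — the CHAIN DRESS over an isolated witnessed `Step0 p` chain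
  (`[CharP K p]`, `d < p`): at a step `k` with chart `a`, translation `t·e_{a′}`, `t ≠ 0`, followed by the pure corner
  `a′`, with shade `d` at `k, k+1, k+2`, inert letters boundary-free at `k` and `e_a ∈ resVertex (c (k+2))`, the
  short non-coset level rows of `(c k).F / x^{r_k}` vanish; `chain_loseBoth_satellite_ledger` is the boundary/order
  ledger of the three states (`r₁ = r_V e_a`, `r₂ = r_V e_a + (r_V + d − p) e_{a′}`, `o₂ + 3p = 2(α + β) + 4d`).
NOT covered (idea-4 §9 CAVEAT): pairs `L → M^k → S` with intervening free moves; coset rows (births).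
[cite: Hauser2010, §I (definition of P⁺)] [cite: CossartJannsenSaito2020, Lemma 13.2, Thm. 13.7]
[cite: HauserPerlega2019PRIMS, §2 (transform D′ of D)]
bears_on: LADDER-RESOLUTION:D157-DOOR2 (res-dim4-pi · K2(p) · K29a row lemma, chain dress).  Supports
stmt-ResolutionOfSingularities-16155 (helper).
-/

set_option linter.dupNamespace false -- mandated namespace of this single-conjunct summit

noncomputable section

namespace Summit.ResolutionOfSingularities.ResolutionOfSingularities.Theorems.PIDim4

namespace ResCone

open MvPolynomial Finset
open Literature.AlgebraicGeometry.Resolution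
open Literature.AlgebraicGeometry.Resolution.CentreBlowup
open Literature.AlgebraicGeometry.Resolution.Hauser2010
open Literature.AlgebraicGeometry.Resolution.HauserPerlega2019

variable {K : Type} [Field K] [DecidableEq K]

/-! ## 1. (RL-b): transport of S-legality back to the sheared parent -/

section Transport

/-- **(RL-b) TRANSPORT through a lose-both step and the immediate satellite** (any `q`, any field).  Let
`s₁ = step_a^{t e_{a′}} s₀` and `s₂ = step_{a′}^{0} s₁`, both parents of order `≥ q` along the point, `ord₀ F₂ = o₂`,
and suppose every degree-`o₂` monomial of `F₂` has `x_a`-exponent `A` («`C₂` on the H-tail»: the residual cone of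
`s₂` is `x_a`-free, `A = r₂ a`).  Then a monomial `x^E` with `|E| > A + q`, off the coset (`q ∤ |E| − q`, or some inert
exponent prime to `q`) and `2|E| + E_{a′} + 2|E|_inert ≤ o₂ + 3q` is ABSENT from `shear_a^{t e_{a′}} F₀`: its chart
images `E₁ = E[a ↦ |E| − q]`, `E₂ = E₁[a′ ↦ |E₁| − q]` are no `q`-th powers, so `coeff_E (shear F₀) = coeff_{E₁} F₁ =
coeff_{E₂} F₂` (`coeff_step_F_chartExponent`), and `|E₂| = 2|E| + E_{a′} + 2|E|_inert − 3q ≤ o₂` with `E₂ a =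
|E| − q ≠ A`. [OURS] [cite: Hauser2010, §I (definition of P⁺)] -/
theorem coeff_shear_eq_zero_of_loseBoth_satellite {q : ℕ} {a a' : Fin 4} (haa : a ≠ a') (t : K)
    {s₀ s₁ s₂ : State K} (hs₁ : s₁ = CentreBlowup.step q Finset.univ a (Pi.single a' t) s₀)
    (hs₂ : s₂ = CentreBlowup.step q Finset.univ a' 0 s₁)
    (hq₀ : (q : ℕ∞) ≤ ordAlong Finset.univ s₀.F) (hq₁ : (q : ℕ∞) ≤ ordAlong Finset.univ s₁.F)
    {o₂ : ℕ} (ho₂ : ordZero s₂.F = o₂) {A : ℕ} (htail : ∀ M ∈ s₂.F.support, M.degree = o₂ → M a = A)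
    {E : Fin 4 →₀ ℕ} (hA : A + q < E.degree)
    (hnc : ¬ q ∣ E.degree - q ∨ ∃ i, i ≠ a ∧ i ≠ a' ∧ ¬ q ∣ E i)
    (hlt : 2 * E.degree + E a' + 2 * degIn ((Finset.univ.erase a).erase a') E ≤ o₂ + 3 * q) :
    coeff E (shear a (Pi.single a' t) s₀.F) = 0 := by
  set P := (Finset.univ.erase a).erase a' with hP
  have hta : (Pi.single a' t : Fin 4 → K) a = 0 := by rw [Pi.single_eq_of_ne haa]
  have hqE : q ≤ E.degree := by omega
  -- the first chart image
  set E₁ := chartExponent q Finset.univ a E with hE₁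
  have hE₁a : E₁ a = E.degree - q := chartExponent_univ_apply_self q a E
  have hE₁i : ∀ i, i ≠ a → E₁ i = E i := fun i hi => chartExponent_apply_of_ne q Finset.univ hi E
  have hE₁deg : E₁.degree + q + E a = 2 * E.degree := degree_chartExponent_univ q a hqE
  have hnp₁ : ¬ IsPthPowerExponent q E₁ := by
    rcases hnc with h | ⟨i, hia, -, hi⟩
    · exact not_isPthPowerExponent_of_not_dvd (i := a) (by rw [hE₁a]; exact h)
    · exact not_isPthPowerExponent_of_not_dvd (i := i) (by rw [hE₁i i hia]; exact hi)
  have h1 : coeff E₁ s₁.F = coeff E (shear a (Pi.single a' t) s₀.F) := by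
    rw [hs₁, coeff_step_F_chartExponent q a hta s₀ hq₀ hqE, if_neg hnp₁]
  rw [← h1]
  -- below the floor of `s₁` the image is absent anyway
  by_cases hqE₁ : q ≤ E₁.degree
  swap
  · by_contra hne
    exact hqE₁ (le_degree_of_mem_support hq₁ (MvPolynomial.mem_support_iff.mpr hne))
  -- the second chart image
  set E₂ := chartExponent q Finset.univ a' E₁ with hE₂
  have hE₂a : E₂ a = E.degree - q := by
    rw [hE₂, chartExponent_apply_of_ne q Finset.univ haa E₁, hE₁a]
  have hE₂i : ∀ i, i ≠ a' → E₂ i = E₁ i := fun i hi => chartExponent_apply_of_ne q Finset.univ hi E₁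
  have hE₂deg : E₂.degree + q + E₁ a' = 2 * E₁.degree := degree_chartExponent_univ q a' hqE₁
  have hnp₂ : ¬ IsPthPowerExponent q E₂ := by
    rcases hnc with h | ⟨i, hia, hia', hi⟩
    · exact not_isPthPowerExponent_of_not_dvd (i := a) (by rw [hE₂a]; exact h)
    · exact not_isPthPowerExponent_of_not_dvd (i := i) (by rw [hE₂i i hia', hE₁i i hia]; exact hi)
  have h2 : coeff E₂ s₂.F = coeff E₁ s₁.F := by
    rw [hs₂, coeff_step_F_chartExponent q a' rfl s₁ hq₁ hqE₁, if_neg hnp₂, shear_zero]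
  rw [← h2]
  by_contra hne
  have hmem : E₂ ∈ s₂.F.support := MvPolynomial.mem_support_iff.mpr hne
  have hge : o₂ ≤ E₂.degree := le_degree_of_mem_support_of_ordZero ho₂ hmem
  -- `|E₂| = 2|E| + E_{a′} + 2|E|_P − 3q ≤ o₂`, so `|E₂| = o₂`; but `E₂ a = |E| − q ≠ A`
  have hsplit := degree_eq_apply_add_apply_add_degIn haa E
  rw [← hP] at hsplit
  have hE₁a' : E₁ a' = E a' := hE₁i a' haa.symm
  have heq : E₂.degree = o₂ := by omega
  have hEa := htail E₂ hmem heq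
  rw [hE₂a] at hEa
  omega

/-- An exponent of POSITIVE inert degree `< q` has an inert coordinate prime to `q` (so its chart images are off the
`q`-th-power coset: the lower levels carry no births). [folklore] -/
theorem exists_inert_not_dvd {q : ℕ} {a a' : Fin 4} {e : Fin 4 →₀ ℕ}
    (h0 : degIn ((Finset.univ.erase a).erase a') e ≠ 0) (hlt : degIn ((Finset.univ.erase a).erase a') e < q) :
    ∃ i, i ≠ a ∧ i ≠ a' ∧ ¬ q ∣ e i := by
  obtain ⟨i, hi, hei⟩ : ∃ i ∈ (Finset.univ.erase a).erase a', e i ≠ 0 := by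
    by_contra hall
    push Not at hall
    exact h0 (degIn_eq_zero_iff.mpr hall)
  have hle : e i ≤ degIn ((Finset.univ.erase a).erase a') e :=
    Finset.single_le_sum (f := fun l => e l) (fun _ _ => Nat.zero_le _) hi
  refine ⟨i, Finset.ne_of_mem_erase (Finset.mem_of_mem_erase hi), Finset.ne_of_mem_erase hi, fun hdvd => ?_⟩
  have := Nat.le_of_dvd (Nat.pos_of_ne_zero hei) hdvd
  omega

end Transport

/-! ## 2. (RL) for the three states -/

section Row

/-- **(RL) THE ROW LEMMA AT AN IMMEDIATE LOSE-BOTH → SATELLITE PAIR, three-state form** (any `q`).  Parent `s₀`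
with boundary `x_a^α x_{a′}^β` (inert letters boundary-free), `x^{r₀} ∣ F₀`, `ord₀ F₀ = α + β + d`; `s₁ =
step_a^{t e_{a′}} s₀` with `t ≠ 0`; `s₂ = step_{a′}^0 s₁` with `ord₀ F₂ = o₂`, `o₂ + 3q = 2(α + β) + 4d` (the shade is
`d` at the three states) and every degree-`o₂` monomial of `F₂` having `x_a`-exponent `α + β + d − q` («`C₂` on the
H-tail»).  Then on every SHORT level row of `G₀ = F₀ / x^{r₀}` — exponents `e` with `e_a + e_{a′} = ℓ + i`, inert degree
`d − ℓ`, `1 ≤ i`, `3i ≤ ℓ ≤ d` — lying off the coset (`q ∤ α + β + d − q + i`, or an inert exponent prime to `q`),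
`coeff_{r₀ + e} F₀ = 0`.  idea-4: «`R^{(ℓ)}_{ℓ+i}(C₀) = 0` for `1 ≤ i ≤ ⌊ℓ/3⌋`».  (§1 supplies the S-legality
vanishing below `N = 2ℓ + 1 − 2i` on the row of the sheared boundary product; the kernel
`level_succ_le_three_mul_of_row_ne_zero` then forces `ℓ + 1 ≤ 3i`.) [OURS]
[cite: Hauser2010, §I (definition of P⁺)] [cite: CossartJannsenSaito2020, Lemma 13.2, Thm. 13.7] -/
theorem row_eq_zero_of_loseBoth_satellite {q : ℕ} {a a' : Fin 4} (haa : a ≠ a') {t : K} (ht : t ≠ 0)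
    {s₀ s₁ s₂ : State K} (hs₁ : s₁ = CentreBlowup.step q Finset.univ a (Pi.single a' t) s₀)
    (hs₂ : s₂ = CentreBlowup.step q Finset.univ a' 0 s₁)
    (hq₀ : (q : ℕ∞) ≤ ordAlong Finset.univ s₀.F) (hq₁ : (q : ℕ∞) ≤ ordAlong Finset.univ s₁.F)
    {α β d : ℕ} (hr₀ : s₀.r = Finsupp.single a α + Finsupp.single a' β)
    (hrle : ∀ m ∈ s₀.F.support, s₀.r ≤ m) (ho₀ : ordZero s₀.F = ((α + β + d : ℕ) : ℕ∞))
    {o₂ : ℕ} (ho₂ : ordZero s₂.F = o₂) (hnum : o₂ + 3 * q = 2 * (α + β) + 4 * d)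
    (htail : ∀ M ∈ s₂.F.support, M.degree = o₂ → M a = α + β + d - q)
    {ℓ i : ℕ} (hℓ : ℓ ≤ d) (hi₁ : 1 ≤ i) (hi : 3 * i ≤ ℓ)
    {e₀ : Fin 4 →₀ ℕ} (he₀ : e₀ a + e₀ a' = ℓ + i)
    (hκ₀ : degIn ((Finset.univ.erase a).erase a') e₀ = d - ℓ)
    (hnc : ¬ q ∣ α + β + d - q + i ∨ ∃ i', i' ≠ a ∧ i' ≠ a' ∧ ¬ q ∣ e₀ i') :
    coeff (s₀.r + e₀) s₀.F = 0 := by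
  set P := (Finset.univ.erase a).erase a' with hP
  -- the floor below the parent order
  have hqo₀ : q ≤ α + β + d := by
    obtain ⟨⟨M, hM, hMdeg⟩, -⟩ := (ordZero_eq_nat_iff s₀.F (α + β + d)).mp ho₀
    have := le_degree_of_mem_support hq₀ (MvPolynomial.mem_support_iff.mpr hM)
    omega
  have hFG : monomial (Finsupp.single a α + Finsupp.single a' β) (1 : K) * s₀.F.divMonomial s₀.r = s₀.F := by
    rw [← hr₀]; exact (eq_monomial_mul_divMonomial hrle).symm
  by_contra hne
  have hGe : coeff e₀ (s₀.F.divMonomial s₀.r) ≠ 0 := by rw [coeff_divMonomial_pair]; exact hne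
  have key := level_succ_le_three_mul_of_row_ne_zero haa ht α β (s₀.F.divMonomial s₀.r) ℓ i (fun i' => e₀ i')
    ?_ he₀ (fun _ _ _ => rfl) hGe
  · omega
  -- S-legality on the row, from §1
  intro e hD hκ hN
  rw [hFG]
  have hκe : degIn P e = degIn P e₀ := Finset.sum_congr rfl fun i' hi' =>
    hκ i' (Finset.ne_of_mem_erase (Finset.mem_of_mem_erase hi')) (Finset.ne_of_mem_erase hi')
  have hdege : e.degree = ℓ + i + (d - ℓ) := by
    rw [degree_eq_apply_add_apply_add_degIn haa e, ← hP, hκe, hκ₀, hD]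
  have hdegE : (e + Finsupp.single a (α + β)).degree = α + β + d + i := by
    rw [map_add, Finsupp.degree_single, hdege]; omega
  have hEa' : (e + Finsupp.single a (α + β)) a' = e a' := by
    rw [Finsupp.add_apply, Finsupp.single_eq_of_ne haa.symm, add_zero]
  have hPE : degIn P (e + Finsupp.single a (α + β)) = d - ℓ := by
    rw [degIn_add, hP, degIn_single_of_not_mem (not_mem_passive_left a a'), add_zero, ← hP, hκe, hκ₀]
  refine coeff_shear_eq_zero_of_loseBoth_satellite haa t hs₁ hs₂ hq₀ hq₁ ho₂ htail (by omega) ?_ ?_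
  · rcases hnc with h | ⟨i', hia, hia', hi'⟩
    · left
      rw [hdegE, show α + β + d + i - q = α + β + d - q + i by omega]
      exact h
    · right
      refine ⟨i', hia, hia', ?_⟩
      rw [Finsupp.add_apply, Finsupp.single_eq_of_ne hia, add_zero, hκ i' hia hia']
      exact hi'
  · rw [hdegE, hEa', ← hP, hPE]
    omega

end Row

/-! ## 3. The chain dress -/

section Chain

variable (p : ℕ) [Fact p.Prime] [CharP K p]

omit [CharP K p] in
/-- **LEDGER OF THE PAIR** along an isolated witnessed `Step0 p` chain: at a step `k` with chart `a` and translation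
`t·e_{a′}`, `t ≠ 0` (lose-both), followed by the pure corner `a′` (immediate satellite), with shade `d` at `k, k+1,
k+2` and the inert letters boundary-free at `k`: `r_k = α e_a + β e_{a′}`, `o_k = α + β + d`; `r_{k+1} = r_V e_a`,
`r_V = o_k − p`, `o_{k+1} = r_V + d`; `r_{k+2} = r_V e_a + (o_{k+1} − p) e_{a′}`, `o_{k+2} + 3p = 2(α + β) + 4d`.
[OURS · bookkeeping] [cite: HauserPerlega2019PRIMS, §2 (transform D′ of D)] -/
theorem chain_loseBoth_satellite_ledger {c : ℕ → State K} {j : ℕ → Fin 4} {b : ℕ → Fin 4 → K}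
    (hc : ∀ k, IsIsolated p (c k).F ∧ Step0 p (c k) (c (k + 1))) (hw : FreeTail.IsWitnessedChain p c j b)
    (hr0 : ∀ e ∈ (c 0).F.support, (c 0).r ≤ e) {d : ℕ} {a a' : Fin 4} (haa : a ≠ a') {k : ℕ}
    (hd₀ : (c k).shade = (d : ℕ∞)) (hd₁ : (c (k + 1)).shade = (d : ℕ∞)) (hd₂ : (c (k + 2)).shade = (d : ℕ∞))
    (hpass : ∀ i, i ≠ a → i ≠ a' → (c k).r i = 0)
    (hjk : j k = a) {t : K} (ht : t ≠ 0) (hbk : b k = Pi.single a' t)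
    (hj₁ : j (k + 1) = a') (hb₁ : b (k + 1) = 0) :
    ∃ o₀ o₁ o₂ : ℕ, ordZero (c k).F = o₀ ∧ ordZero (c (k + 1)).F = o₁ ∧ ordZero (c (k + 2)).F = o₂ ∧
      (c k).r = Finsupp.single a ((c k).r a) + Finsupp.single a' ((c k).r a') ∧
      o₀ = (c k).r a + (c k).r a' + d ∧ p ≤ o₀ ∧
      (c (k + 1)).r = Finsupp.single a (o₀ - p) ∧ o₁ = o₀ - p + d ∧ p ≤ o₁ ∧
      (c (k + 2)).r = Finsupp.single a (o₀ - p) + Finsupp.single a' (o₁ - p) ∧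
      o₂ = (o₀ - p) + (o₁ - p) + d ∧ o₂ + 3 * p = 2 * ((c k).r a + (c k).r a') + 4 * d ∧
      c (k + 1) = CentreBlowup.step p Finset.univ a (Pi.single a' t) (c k) ∧
      c (k + 2) = CentreBlowup.step p Finset.univ a' 0 (c (k + 1)) := by
  obtain ⟨o₀, ho₀, hpo₀, -⟩ := BandShade.exists_ordZero_eq p hc k
  obtain ⟨o₁, ho₁, hpo₁, -⟩ := BandShade.exists_ordZero_eq p hc (k + 1)
  obtain ⟨o₂, ho₂, -, -⟩ := BandShade.exists_ordZero_eq p hc (k + 2)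
  have hrk₀ := IsolatedBand.isolated_chain_forall_le hc hr0 k
  have hrk₁ := IsolatedBand.isolated_chain_forall_le hc hr0 (k + 1)
  have hrk₂ := IsolatedBand.isolated_chain_forall_le hc hr0 (k + 2)
  have hsd₀ := ordZero_sub_degree_eq_of_shade ho₀ hd₀
  have hsd₁ := ordZero_sub_degree_eq_of_shade ho₁ hd₁
  have hsd₂ := ordZero_sub_degree_eq_of_shade ho₂ hd₂
  have hle₀ := degree_r_le ho₀ hrk₀
  have hle₁ := degree_r_le ho₁ hrk₁
  have hle₂ := degree_r_le ho₂ hrk₂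
  have hstep1 : c (k + 1) = CentreBlowup.step p Finset.univ a (Pi.single a' t) (c k) := by
    rw [(hw k).2.2.2.2, hjk, hbk]
  have hstep2 : c (k + 2) = CentreBlowup.step p Finset.univ a' 0 (c (k + 1)) := by
    rw [(hw (k + 1)).2.2.2.2, hj₁, hb₁]
  -- time `k`
  have hr₀ : (c k).r = Finsupp.single a ((c k).r a) + Finsupp.single a' ((c k).r a') := by
    ext i
    rw [two_apply haa]
    by_cases hia : i = a
    · rw [if_pos hia, hia]
    · rw [if_neg hia]
      by_cases hia' : i = a'
      · rw [if_pos hia', hia']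
      · rw [if_neg hia', hpass i hia hia']
  have hρ : (c k).r.degree = (c k).r a + (c k).r a' := by
    rw [hr₀, map_add, Finsupp.degree_single, Finsupp.degree_single, ← hr₀]
  -- time `k + 1`
  have hta : (Pi.single a' t : Fin 4 → K) a = 0 := by rw [Pi.single_eq_of_ne haa]
  have hr₁ : (c (k + 1)).r = Finsupp.single a (o₀ - p) := by
    rw [hstep1, step_r_univ p a hta (c k) ho₀ hrk₀]
    ext i
    rw [Finsupp.coe_update, Finsupp.single_apply]
    by_cases hia : i = a
    · rw [hia, Function.update_self, if_pos rfl]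
    · rw [Function.update_of_ne hia, Finsupp.filter_apply, if_neg (Ne.symm hia)]
      by_cases hia' : i = a'
      · rw [hia', Pi.single_eq_same, if_neg ht]
      · rw [Pi.single_eq_of_ne hia', if_pos rfl, hpass i hia hia']
  have hρ₁ : (c (k + 1)).r.degree = o₀ - p := by rw [hr₁, Finsupp.degree_single]
  -- time `k + 2`
  have hr₂law := step_r_univ p a' (b := (0 : Fin 4 → K)) rfl (c (k + 1)) ho₁ hrk₁
  rw [← hstep2] at hr₂law
  have hr₂ : (c (k + 2)).r = Finsupp.single a (o₀ - p) + Finsupp.single a' (o₁ - p) := by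
    ext i
    rw [hr₂law, Finsupp.coe_update, two_apply haa]
    by_cases hia' : i = a'
    · rw [hia', Function.update_self, if_neg haa.symm, if_pos rfl]
    · rw [Function.update_of_ne hia', Finsupp.filter_apply, if_pos (show (0 : Fin 4 → K) i = 0 from rfl), hr₁,
        Finsupp.single_apply]
      by_cases hia : i = a
      · rw [if_pos hia.symm, if_pos hia]
      · rw [if_neg (Ne.symm hia), if_neg hia, if_neg hia']
  have hρ₂ : (c (k + 2)).r.degree = (o₀ - p) + (o₁ - p) := by
    rw [hr₂, map_add, Finsupp.degree_single, Finsupp.degree_single]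
  refine ⟨o₀, o₁, o₂, ho₀, ho₁, ho₂, hr₀, by omega, hpo₀, hr₁, by omega, hpo₁, hr₂, by omega, by omega,
    hstep1, hstep2⟩

/-- **(RL) ON THE CHAIN — K29a LAYER 1.**  Along an isolated witnessed `Step0 p` chain with `x^{r₀} ∣ F₀`, let the
step `k` be a LOSE-BOTH (chart `a`, translation `t·e_{a′}`, `t ≠ 0`) followed by the IMMEDIATE SATELLITE (chart
`a′` at the origin), with shade `d < p` at `k, k+1, k+2`, the inert letters boundary-free at `k`, and the grandchild
ON THE H-TAIL in the sense `e_a ∈ resVertex (c (k+2))` (its residual cone does not involve `x_a`; tilt-free frames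
have this at every index).  Then every SHORT level row of `(c k).F / x^{r_k}` — exponents `e` with
`e_a + e_{a′} = ℓ + i`, inert degree `d − ℓ`, `1 ≤ i`, `3i ≤ ℓ ≤ d` — off the coset (`ℓ < d`, or `p ∤ r_V + i` with
`r_V = r_k a + r_k a′ + d − p`) has `coeff_{r_k + e} (c k).F = 0`: idea-4's `R^{(ℓ)}_{ℓ+i}(C₀) = 0`,
`1 ≤ i ≤ ⌊ℓ/3⌋`, at every level `3 ≤ ℓ ≤ d`. [OURS] [cite: Hauser2010, §I (definition of P⁺)]
[cite: CossartJannsenSaito2020, Lemma 13.2, Thm. 13.7] [cite: HauserPerlega2019PRIMS, §2 (transform D′ of D)] -/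
theorem chain_row_eq_zero_of_loseBoth_satellite {c : ℕ → State K} {j : ℕ → Fin 4} {b : ℕ → Fin 4 → K}
    (hc : ∀ k, IsIsolated p (c k).F ∧ Step0 p (c k) (c (k + 1))) (hw : FreeTail.IsWitnessedChain p c j b)
    (hr0 : ∀ e ∈ (c 0).F.support, (c 0).r ≤ e) {d : ℕ} (hdp : d < p) {a a' : Fin 4} (haa : a ≠ a') {k : ℕ}
    (hd₀ : (c k).shade = (d : ℕ∞)) (hd₁ : (c (k + 1)).shade = (d : ℕ∞)) (hd₂ : (c (k + 2)).shade = (d : ℕ∞))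
    (hpass : ∀ i, i ≠ a → i ≠ a' → (c k).r i = 0)
    (hjk : j k = a) {t : K} (ht : t ≠ 0) (hbk : b k = Pi.single a' t)
    (hj₁ : j (k + 1) = a') (hb₁ : b (k + 1) = 0)
    (htilt : (Pi.single a 1 : Fin 4 → K) ∈ resVertex (c (k + 2)))
    {ℓ i : ℕ} (hℓ : ℓ ≤ d) (hi₁ : 1 ≤ i) (hi : 3 * i ≤ ℓ)
    (hnc : ℓ < d ∨ ¬ p ∣ (c k).r a + (c k).r a' + d - p + i)
    {e₀ : Fin 4 →₀ ℕ} (he₀ : e₀ a + e₀ a' = ℓ + i)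
    (hκ₀ : degIn ((Finset.univ.erase a).erase a') e₀ = d - ℓ) :
    coeff ((c k).r + e₀) (c k).F = 0 := by
  obtain ⟨o₀, o₁, o₂, ho₀, ho₁, ho₂, hr₀, ho₀', -, -, -, -, hr₂, ho₂', hnum, hstep1, hstep2⟩ :=
    chain_loseBoth_satellite_ledger p hc hw hr0 haa hd₀ hd₁ hd₂ hpass hjk ht hbk hj₁ hb₁
  have hrk₀ := IsolatedBand.isolated_chain_forall_le hc hr0 k
  have hrk₂ := IsolatedBand.isolated_chain_forall_le hc hr0 (k + 2)
  have hρ₂ : (c (k + 2)).r.degree = (o₀ - p) + (o₁ - p) := by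
    rw [hr₂, map_add, Finsupp.degree_single, Finsupp.degree_single]
  have hr₂a : (c (k + 2)).r a = o₀ - p := by rw [hr₂, two_apply haa, if_pos rfl]
  -- «C₂ on the H-tail»: the degree-`o₂` monomials of `F₂` have `x_a`-exponent `r₂ a`
  have htail : ∀ M ∈ (c (k + 2)).F.support, M.degree = o₂ → M a = (c k).r a + (c k).r a' + d - p := by
    intro M hM hMdeg
    have hfree := (single_mem_resVertex_iff_free p ho₂ (by rw [hρ₂]; omega) a).mp htilt (M - (c (k + 2)).r)
      (sub_mem_support_resForm ho₂ hrk₂ hM hMdeg)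
    have hle := Finsupp.le_def.mp (hrk₂ M hM) a
    rw [Finsupp.tsub_apply, hr₂a] at hfree
    rw [hr₂a] at hle
    omega
  have hnc' : ¬ p ∣ (c k).r a + (c k).r a' + d - p + i ∨ ∃ i', i' ≠ a ∧ i' ≠ a' ∧ ¬ p ∣ e₀ i' := by
    rcases hnc with hlt | h
    · exact Or.inr (exists_inert_not_dvd (by rw [hκ₀]; omega) (by rw [hκ₀]; omega))
    · exact Or.inl h
  have ho₀'' : ordZero (c k).F = (((c k).r a + (c k).r a' + d : ℕ) : ℕ∞) := by rw [ho₀, ho₀']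
  exact row_eq_zero_of_loseBoth_satellite haa ht hstep1 hstep2 (hw k).1 (hw (k + 1)).1 hr₀ hrk₀ ho₀'' ho₂
    (by omega) htail hℓ hi₁ hi he₀ hκ₀ hnc'

end Chain

end ResCone

end Summit.ResolutionOfSingularities.ResolutionOfSingularities.Theorems.PIDim4

end
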